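/-
Copyright: the b2b-balaban cell (near-miss cell 7), T⁴-continuum fan-out, lineage t4-ne7b-p1 (node U5c COUNT member).
Released under the licence of the surrounding project.
-/
import Summits.QuantumFields.BalabanUV.T4Continuum.Support.ZoneDiameter
import Literature.MathematicalPhysics.QuantumFieldTheory.Balaban1983to89.TreeLength

/-!
# Zone birth extent: a face-connected family of `N` cubes has sup-diameter `≤ N − 1`, hence `≤ 2^d(4d′+1) − 1`

Summits-side support leaf of the T⁴-continuum cell (rung (B)+1 on a FINITE torus only; NOT infinite volume, NOT the
mass gap, NOT the Clay statement; NOT a proof of the spine estimate NE7b).  Lineage `t4-ne7b-p1` (generation 20),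
node U5c, wall (GM), located item G-ne7bp1g20-B (the BIRTH inequality of `ZoneExtentLaw.ZoneDyn`).  [folklore]
finite geometry of `ℤ^d` and of `(ℤ∕m)^d`; nothing is quoted from print and nothing printed is asserted; no `[cite:]`
tag.  The only imported Literature facts are the cell's index-model definitions (`B13ScaleTransfer.{Pt, Adj, Linked,
FaceConnected}`) and the PROVED repaired count `TreeLength.card_le_treeLen` (`#Y ≤ 2^d(4·treeLen Y + 1)`).

WHY.  `ZoneDyn.birth` asks that a new structure's zone span at most `Cb·wt b = Cb·(d′+1)` blocks.  In the cell's
index model a large-field component is a FACE-CONNECTED family `Z ⊆ ℤ^d` of cubes of fatness `d′ = treeLen Z`, with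
`#Z ≤ 2^d(4d′+1)` cubes.  This leaf supplies the missing (ID)-free link «few cubes ⇒ small diameter»:
* §1 **`natAbs_sub_lt_card`**: in a face-connected family, every coordinate of two members differs by LESS than the
  number of cubes (discrete intermediate values: a chain of wall-sharing cubes from `x` to `y` passes through a cube with
  EVERY intermediate `i`-th coordinate, so the `i`-th coordinates of the family fill an interval of length `|x_i − y_i|`);
  **`natAbs_sub_le_treeLen`**: hence `|x_i − y_i| ≤ 2^d(4·treeLen Z + 1) − 1`.
* §2 REDUCTION TO THE TORUS does not increase distances: `cycd_res_le_natAbs` (`cycd m (res m a) (res m b) ≤ |a − b|`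
  for integers, `m > 0`); so the zone `redZone m Z` (coordinatewise residues) has `diam m (redZone m Z) ≤ #Z − 1`
  (`diam_redZone_le_card`) and `≤ 2^d(4·treeLen Z + 1) − 1 ≤ (4·2^d)·(treeLen Z + 1)` (`diam_redZone_le_treeLen`) —
  the shape `Cb·(d′+1)` of `ZoneDyn.birth` with `Cb = 4·2^d` (`= 64` at `d = 4`) when the reading takes the birth zone
  to be the reduced family (any translation ∕ common blocking of `Z` is again a face-connected family of at most as
  many cubes, so the same bound applies to it).

WHAT THIS LEAVES TO THE READING (ID) (G-ne7bp1g9-1): that the birth zone of a class-`d′` structure IS (a translate ∕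
blocking of) the reduced cube family of a face-connected `Z` with `treeLen Z ≤ d′` (collars, if the reading adds them,
enlarge `#Z` by a located factor — `T4EntropyShapeInstances.card_zone_le`).  (E2)∕(R1) untouched.

HONEST DEPENDENCY (cell): continuum YM on T⁴ ⇐ BetaPertH ∧ nine spine estimates (0/9 proved); BetaPertH ⇐ (D1) ∧ (D4)
∧ CAP+tail.  This file changes none of it.
-/

open Finset
open Literature.MathematicalPhysics.QuantumFieldTheory.Balaban1983to89.B13ScaleTransfer
open Literature.MathematicalPhysics.QuantumFieldTheory.Balaban1983to89.TreeLength

namespace Summit.QuantumFields.BalabanUV.T4Continuum.ZoneTorus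

variable {d : ℕ}

/-! ## §1 Face-connected families: coordinates differ by less than the number of cubes -/

/-- wall-sharing cubes differ by at most one in every coordinate [folklore] -/
theorem natAbs_sub_le_one_of_adj {x y : Pt d} (h : Adj x y) (i : Fin d) : Int.natAbs (x i - y i) ≤ 1 := by
  obtain ⟨j, h | h⟩ := h
  · rw [h]
    by_cases hij : i = j
    · subst hij; simp
    · simp [Function.update_of_ne hij]
  · rw [h]
    by_cases hij : i = j
    · subst hij; simp
    · simp [Function.update_of_ne hij]

/-- **DISCRETE INTERMEDIATE VALUES.**  Along a chain of wall-sharing cubes inside `S` from `x ∈ S` to `y`, every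
integer between `x_i` and `y_i` is the `i`-th coordinate of a cube of `S`. [folklore] -/
theorem exists_mem_coord_eq_of_linked {S : Finset (Pt d)} {x y : Pt d} (hx : x ∈ S) (h : Linked S x y) (i : Fin d)
    {v : ℤ} (hv1 : min (x i) (y i) ≤ v) (hv2 : v ≤ max (x i) (y i)) : ∃ z ∈ S, z i = v := by
  induction h generalizing v with
  | refl =>
      refine ⟨x, hx, ?_⟩
      simp only [min_self, max_self] at hv1 hv2
      omega
  | tail hab hbc ih =>
      rename_i b c
      have h1 := natAbs_sub_le_one_of_adj hbc.2.2 i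
      have hc : c ∈ S := hbc.2.1
      -- either `v` lies between `x_i` and `b_i` (induction) or `v = c_i`
      by_cases hvc : v = c i
      · exact ⟨c, hc, hvc.symm⟩
      · apply ih
        · have : (b i - c i).natAbs ≤ 1 := h1
          omega
        · have : (b i - c i).natAbs ≤ 1 := h1
          omega

/-- **IN A FACE-CONNECTED FAMILY EVERY COORDINATE OF TWO MEMBERS DIFFERS BY LESS THAN THE NUMBER OF CUBES.**
[folklore] -/
theorem natAbs_sub_lt_card {S : Finset (Pt d)} (hS : FaceConnected S) {x y : Pt d} (hx : x ∈ S) (hy : y ∈ S)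
    (i : Fin d) : Int.natAbs (x i - y i) < S.card := by
  -- the `i`-th coordinates of `S` contain the whole integer interval between `x_i` and `y_i`
  have hsub : Finset.Icc (min (x i) (y i)) (max (x i) (y i)) ⊆ S.image fun z => z i := by
    intro v hv
    rw [mem_Icc] at hv
    obtain ⟨z, hz, hzv⟩ := exists_mem_coord_eq_of_linked hx (hS x hx y hy) i hv.1 hv.2
    exact mem_image.2 ⟨z, hz, hzv⟩
  have hcard := (card_le_card hsub).trans card_image_le
  rw [Int.card_Icc] at hcard
  have : (max (x i) (y i) + 1 - min (x i) (y i)).toNat = Int.natAbs (x i - y i) + 1 := by omega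
  omega

/-- … hence, with the repaired cube count `#Z ≤ 2^d(4·treeLen Z + 1)` of the tree:
`|x_i − y_i| ≤ 2^d(4·treeLen Z + 1) − 1`. [folklore] -/
theorem natAbs_sub_le_treeLen {Z : Finset (Pt d)} (hZ : FaceConnected Z) {x y : Pt d} (hx : x ∈ Z) (hy : y ∈ Z)
    (i : Fin d) : (Int.natAbs (x i - y i) : ℝ) ≤ 2 ^ d * (4 * treeLen Z + 1) - 1 := by
  have h1 : (Int.natAbs (x i - y i) : ℝ) + 1 ≤ Z.card := by
    exact_mod_cast Nat.succ_le_of_lt (natAbs_sub_lt_card hZ hx hy i)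
  have h2 := card_le_treeLen ⟨x, hx⟩ hZ
  linarith

/-! ## §2 Reduction to the torus does not increase distances -/

/-- the residue of an integer mod `m > 0`, as a natural number `< m` [folklore] -/
def res (m : ℕ) (a : ℤ) : ℕ := (a % (m : ℤ)).toNat

/-- `res m a < m` [folklore] -/
theorem res_lt {m : ℕ} (hm : 0 < m) (a : ℤ) : res m a < m := by
  have hm' : (0 : ℤ) < m := by exact_mod_cast hm
  have h0 := Int.emod_nonneg a hm'.ne'
  have h1 := Int.emod_lt_of_pos a hm'
  unfold res
  omega

/-- **REDUCTION MOD `m` DOES NOT INCREASE DISTANCES**: `cycd m (res m a) (res m b) ≤ |a − b|`. [folklore] -/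
theorem cycd_res_le_natAbs {m : ℕ} (hm : 0 < m) (a b : ℤ) : cycd m (res m a) (res m b) ≤ Int.natAbs (a - b) := by
  have hm' : (0 : ℤ) < m := by exact_mod_cast hm
  have ha0 := Int.emod_nonneg a hm'.ne'
  have ha1 := Int.emod_lt_of_pos a hm'
  have hb0 := Int.emod_nonneg b hm'.ne'
  have hb1 := Int.emod_lt_of_pos b hm'
  -- `a % m − b % m ≡ a − b (mod m)` with both sides in `(−m, m)`: they differ by `0` or `±m`
  obtain ⟨k, hk⟩ : ∃ k : ℤ, a % m - b % m = (a - b) - m * k := by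
    refine ⟨a / m - b / m, ?_⟩
    have ha := Int.emod_def a m
    have hb := Int.emod_def b m
    linear_combination ha - hb
  by_cases hbig : (m : ℤ) ≤ Int.natAbs (a - b)
  · exact le_trans (cycd_le _ _ _) (by exact_mod_cast hbig)
  · push Not at hbig
    -- `|a − b| < m` forces `k ∈ {−1, 0, 1}`
    have hk1 : k ≤ 1 := by
      by_contra h
      have h2 : (2 : ℤ) ≤ k := by omega
      have h3 := mul_le_mul_of_nonneg_left h2 hm'.le
      omega
    have hk2 : -1 ≤ k := by
      by_contra h
      have h2 : k ≤ -2 := by omega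
      have h3 := mul_le_mul_of_nonneg_left h2 hm'.le
      omega
    unfold cycd res Nat.dist
    interval_cases k <;> omega

/-- THE REDUCED ZONE: the coordinatewise residues mod `m` of a family of cubes of `ℤ^d`. [folklore] -/
def redZone (m : ℕ) (Z : Finset (Pt d)) : Finset (Fin d → ℕ) := Z.image fun x i => res m (x i)

/-- the reduced zone is in range [folklore] -/
theorem inRange_redZone {m : ℕ} (hm : 0 < m) (Z : Finset (Pt d)) : InRange m (redZone m Z) := by
  intro u hu i
  obtain ⟨x, _, rfl⟩ := mem_image.1 hu
  exact res_lt hm (x i)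

/-- reduction does not increase the sup-distance [folklore] -/
theorem cdist_red_le {m : ℕ} (hm : 0 < m) (x y : Pt d) (r : ℕ) (h : ∀ i, Int.natAbs (x i - y i) ≤ r) :
    cdist m (fun i => res m (x i)) (fun i => res m (y i)) ≤ r :=
  cdist_le_iff.2 fun i => (cycd_res_le_natAbs hm (x i) (y i)).trans (h i)

/-- **A FACE-CONNECTED FAMILY OF `N` CUBES REDUCES TO A ZONE OF DIAMETER `≤ N − 1`.** [folklore] -/
theorem diam_redZone_le_card {m : ℕ} (hm : 0 < m) {Z : Finset (Pt d)} (hZ : FaceConnected Z) :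
    diam m (redZone m Z) ≤ Z.card - 1 := by
  rw [diam_le_iff]
  intro u hu v hv
  obtain ⟨x, hx, rfl⟩ := mem_image.1 hu
  obtain ⟨y, hy, rfl⟩ := mem_image.1 hv
  exact cdist_red_le hm x y _ fun i => Nat.le_sub_one_of_lt (natAbs_sub_lt_card hZ hx hy i)

/-- **THE BIRTH-EXTENT SHAPE OF `ZoneDyn`**: for a non-empty face-connected family `Z`,
`diam m (redZone m Z) ≤ 2^d(4·treeLen Z + 1) − 1 ≤ (4·2^d)·(treeLen Z + 1)` — `Cb·(d′+1)` with `Cb = 4·2^d` when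
`treeLen Z ≤ d′`. [folklore] -/
theorem diam_redZone_le_treeLen {m : ℕ} (hm : 0 < m) {Z : Finset (Pt d)} (hne : Z.Nonempty) (hZ : FaceConnected Z) :
    (diam m (redZone m Z) : ℝ) ≤ 4 * 2 ^ d * (treeLen Z + 1) := by
  have h1 : (diam m (redZone m Z) : ℝ) ≤ (Z.card : ℝ) - 1 := by
    have h := diam_redZone_le_card hm hZ
    have hc : 1 ≤ Z.card := card_pos.2 hne
    have : ((Z.card - 1 : ℕ) : ℝ) = (Z.card : ℝ) - 1 := by rw [Nat.cast_sub hc]; simp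
    rw [← this]; exact_mod_cast h
  have h2 := card_le_treeLen hne hZ
  have h3 : (0 : ℝ) ≤ 2 ^ d := by positivity
  nlinarith

/-- … in the currency of the chain's weights: if `treeLen Z ≤ d′` then `diam ≤ (4·2^d)·(d′ + 1)`. [folklore] -/
theorem diam_redZone_le_fat {m : ℕ} (hm : 0 < m) {Z : Finset (Pt d)} (hne : Z.Nonempty) (hZ : FaceConnected Z)
    {fat : ℝ} (hfat : treeLen Z ≤ fat) : (diam m (redZone m Z) : ℝ) ≤ 4 * 2 ^ d * (fat + 1) := by
  have h := diam_redZone_le_treeLen hm hne hZ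
  have h3 : (0 : ℝ) ≤ 4 * 2 ^ d := by positivity
  nlinarith

/-! ## §3 Sanity -/

namespace Sanity

/-- residues: `res 5 (−1) = 4`, `res 5 7 = 2`, and their cyclic distance `2 ≤ |−1 − 7| = 8` -/
theorem res_example : res 5 (-1) = 4 ∧ res 5 7 = 2 ∧ cycd 5 (res 5 (-1)) (res 5 7) = 2 := by decide

/-- the constant at `d = 4`: `Cb = 4·2^4 = 64` -/
theorem Cb_four : (4 : ℝ) * 2 ^ 4 = 64 := by norm_num

end Sanity

end Summit.QuantumFields.BalabanUV.T4Continuum.ZoneTorus
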